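import Summits.ResolutionOfSingularities.ResolutionOfSingularities.Theorems.PurelyInseparableDim4JointChartNormalise
import HarnessLib

/-!
# Purely inseparable four-folds: the assembled step of the monotone joint forest THROUGH A GIVEN COMPARISON `ε`, with the
# MODEL DESCRIPTIONS of the children exported (brick S3 (c) «joint point∘coordinate chains», part 37a, cell `res-dim4-pi`;
# input of the v3-lite step with waiting members, part 37)

[OURS · counted 0] (D-0157 DOOR 2; desk WORD #66 (4)(c), #74 (g), #99 (d); frame `PIDim4.TerminationImpliesOrderReduction`,
S3 (c) v3-lite; host item stmt-ResolutionOfSingularities-16155, helper). Nothing here proves resolution of singularities in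
dimension ≥ 4 / characteristic `p` — NOT here, not anywhere in this programme.

Part 19's `joint_forest_step_normalised`, verbatim, EXCEPT that (i) the model blowing up `B` of `V(z, x_S)` and the comparison
`ε : π⁻¹φ(Y) ≅ B⁻¹ψ(Y)` (square `hsq`, centre identity `hC'`, transform transport `hKEY`, typ-2's
`exists_iso_restrict_blowup_zigzag`) are INPUTS instead of being chosen inside the proof, and (ii) for every plan entry `e`
the child's re-centring `Θ_e` and its MODEL DESCRIPTION `w ∈ kid e ⟺ ι(ε w) ∈ T_B(e)` (part 12) are EXPORTED. The v3-lite
step (part 37) needs both to compare the children with the WAITING kids of part 35 inside the same model.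

* **`joint_forest_step_model`** — children with data and model descriptions, pairwise disjoint, cover over the member by
  children and leaf charts (normalised pairs), finiteness of the leaf points.

AI-produced formalisation, weaker than expert review. bears_on: LADDER-RESOLUTION:D157-DOOR2 (res-dim4-pi · S3 (c) v3-lite).
-/

set_option linter.dupNamespace false -- D-0017: single-problem summit path `Summit.<S>.<S>.…` by design

noncomputable section

open MvPolynomial Finset CategoryTheory AlgebraicGeometry Opposite TopologicalSpace
open AlgebraicGeometry.Scheme.IdealSheafData (ofIdealTop vanishingIdeal)

namespace Summit.ResolutionOfSingularities.ResolutionOfSingularities.Theorems.PIDim4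

open Literature.AlgebraicGeometry.Resolution
open Literature.AlgebraicGeometry.Resolution.Hauser2010
open Literature.AlgebraicGeometry.Resolution.AffinePointBlowup (P A γ coord Wtop ξ)

namespace Equimultiple

section Assembly

variable {K : Type} [Field K] {p : ℕ} [hp : Fact p.Prime] [CharP K p] [DecidableEq K]
variable {Z Y W Bl : Scheme.{0}} (φ : Y ⟶ Z) [IsOpenImmersion φ] (ψ : Y ⟶ P 4 K) [IsOpenImmersion ψ]
  {π : W ⟶ Z} {B : Bl ⟶ P 4 K} {S : Finset (Fin 4)}
  (ε : (π ⁻¹ᵁ φ.opensRange : Scheme.{0}) ≅ (B ⁻¹ᵁ ψ.opensRange : Scheme.{0}))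

/-- **THE ASSEMBLED STEP OF THE MONOTONE JOINT FOREST THROUGH A GIVEN `ε`, MODEL DESCRIPTIONS EXPORTED.** See the module
docstring. [cite: BierstoneGrigorievMilmanWlodarczyk2011, Def. 3.1.3; §4 Step 2b] [cite: Hauser2010, §F (equiconstant points)]
[cite: GortzWedhorn2020, Prop. 13.91] -/
theorem joint_forest_step_model [IsLocallyNoetherian Z] [IsAlgClosed K] (Zc : Z.IdealSheafData)
    (hπ : IsBlowup π Zc) (hB : IsBlowup B (AffineCoordBlowup.𝓘Λ 4 K (insert 0 (Fin.succ '' (S : Set (Fin 4))))))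
    (hsq : ε.hom ≫ (B ∣_ ψ.opensRange) = (π ∣_ φ.opensRange) ≫ (φ.isoOpensRange.inv ≫ ψ.isoOpensRange.hom))
    (hC' : ((AffineCoordBlowup.𝓘Λ 4 K (insert 0 (Fin.succ '' (S : Set (Fin 4))))).comap ψ.opensRange.ι).comap
        (φ.isoOpensRange.inv ≫ ψ.isoOpensRange.hom) = Zc.comap φ.opensRange.ι)
    (M : MarkedIdeal Z) (hmult : M.mult = p) (s : State K)
    (hK : ((controlledTransform B (AffineCoordBlowup.𝓘Λ 4 K (insert 0 (Fin.succ '' (S : Set (Fin 4)))))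
        (hypSheaf p s.F) p).comap (B ⁻¹ᵁ ψ.opensRange).ι).comap ε.hom =
      (controlledTransform π Zc M.ideal p).comap (π ⁻¹ᵁ φ.opensRange).ι) (hS : IsPermissibleCentre p S s.F)
    (hsee : (AffineCoordBlowup.CΛ 4 K (insert 0 (Fin.succ '' (S : Set (Fin 4)))) : Set (P 4 K)) ⊆ Set.range ψ)
    (hT : IsClosed (φ '' (ψ ⁻¹' (AffineCoordBlowup.CΛ 4 K (insert 0 (Fin.succ '' (S : Set (Fin 4)))) : Set (P 4 K)))))
    (hsncZ : HasSNCWith M.boundary Zc) (idx : Z.IdealSheafData → Fin 4) (cst : Z.IdealSheafData → K)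
    (hshape : ∀ D ∈ M.boundary,
      ((D.support : Set Z) ∩ φ '' (ψ ⁻¹'
        (AffineCoordBlowup.CΛ 4 K (insert 0 (Fin.succ '' (S : Set (Fin 4)))) : Set (P 4 K)))).Nonempty →
      D.comap φ = (ofIdealTop (Ideal.span {(γ 4 K).symm (X (idx D).succ + C (cst D))})).comap ψ ∧
        (idx D ∈ S → cst D = 0))
    (hinj : ∀ D₁ ∈ M.boundary, ∀ D₂ ∈ M.boundary,
      ((D₁.support : Set Z) ∩ φ '' (ψ ⁻¹'
        (AffineCoordBlowup.CΛ 4 K (insert 0 (Fin.succ '' (S : Set (Fin 4)))) : Set (P 4 K)))).Nonempty →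
      ((D₂.support : Set Z) ∩ φ '' (ψ ⁻¹'
        (AffineCoordBlowup.CΛ 4 K (insert 0 (Fin.succ '' (S : Set (Fin 4)))) : Set (P 4 K)))).Nonempty →
      idx D₁ = idx D₂ → D₁ = D₂)
    (Pl : Finset (Fin 4 × (Fin 4 → K) × Finset (Fin 4)))
    (hP1 : ∀ e ∈ Pl, e.1 ∈ S ∧ e.2.1 e.1 = 0 ∧ S ⊆ e.2.2 ∧ CentreBlowup.IsEquimultiplePoint p S e.1 e.2.1 s ∧
      IsPermissibleCentre p e.2.2 (CentreBlowup.step p S e.1 e.2.1 s).F)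
    (hP2 : ∀ e ∈ Pl, ∀ e' ∈ Pl, e ≠ e' →
      (e.1 = e'.1 ∧ ∃ i ∈ e.2.2, i ∈ e'.2.2 ∧ e.2.1 i ≠ e'.2.1 i) ∨
      (e.1 ≠ e'.1 ∧ ((e'.2.1 e.1 = 0 ∧ e.1 ∈ e'.2.2) ∨ (e.2.1 e'.1 = 0 ∧ e'.1 ∈ e.2.2))))
    (L : Finset (Fin 4 × (Fin 4 → K)))
    (hP5 : ∀ (j' : Fin 4) (b' : Fin 4 → K), j' ∈ S → b' j' = 0 → (∀ k ∈ S, k < j' → b' k = 0) →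
      CentreBlowup.IsEquimultiplePoint p S j' b' s →
      (∃ e ∈ Pl, e.1 = j' ∧ ∀ i ∈ e.2.2, b' i = e.2.1 i) ∨ (j', b') ∈ L) :
    ∃ kid : Fin 4 × (Fin 4 → K) × Finset (Fin 4) → Closeds W,
      (∀ (e : Fin 4 × (Fin 4 → K) × Finset (Fin 4)) (he : e ∈ Pl),
        Scheme.IsRegular (vanishingIdeal (kid e)).subscheme ∧
        HasSNCWith (M.transform π Zc).boundary (vanishingIdeal (kid e)) ∧
        (∃ (Y'' : Scheme.{0}) (φ'' : Y'' ⟶ W) (ψ'' : Y'' ⟶ P 4 K) (_ : IsOpenImmersion φ'') (_ : IsOpenImmersion ψ''),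
          (M.transform π Zc).ideal.comap φ'' = (hypSheaf p (CentreBlowup.step p S e.1 e.2.1 s).F).comap ψ'' ∧
          (vanishingIdeal (kid e)).comap φ'' =
            (AffineCoordBlowup.𝓘Λ 4 K (insert 0 (Fin.succ '' ((e.2.2 : Finset (Fin 4)) : Set (Fin 4))))).comap ψ'' ∧
          (kid e : Set W) ⊆ Set.range φ'' ∧
          (AffineCoordBlowup.CΛ 4 K (insert 0 (Fin.succ '' ((e.2.2 : Finset (Fin 4)) : Set (Fin 4)))) : Set (P 4 K)) ⊆
            Set.range ψ'' ∧
          ∃ (idx₂ : W.IdealSheafData → Fin 4) (cst₂ : W.IdealSheafData → K),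
            (∀ D₂ ∈ (M.transform π Zc).boundary,
              ((D₂.support : Set W) ∩ φ'' '' (ψ'' ⁻¹'
                (AffineCoordBlowup.CΛ 4 K (insert 0 (Fin.succ '' ((e.2.2 : Finset (Fin 4)) : Set (Fin 4)))) :
                  Set (P 4 K)))).Nonempty →
              D₂.comap φ'' = (ofIdealTop (Ideal.span {(γ 4 K).symm (X (idx₂ D₂).succ + C (cst₂ D₂))})).comap ψ'' ∧
                (idx₂ D₂ ∈ e.2.2 → cst₂ D₂ = 0)) ∧
            (∀ D₁ ∈ (M.transform π Zc).boundary, ∀ D₂ ∈ (M.transform π Zc).boundary,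
              ((D₁.support : Set W) ∩ φ'' '' (ψ'' ⁻¹'
                (AffineCoordBlowup.CΛ 4 K (insert 0 (Fin.succ '' ((e.2.2 : Finset (Fin 4)) : Set (Fin 4)))) :
                  Set (P 4 K)))).Nonempty →
              ((D₂.support : Set W) ∩ φ'' '' (ψ'' ⁻¹'
                (AffineCoordBlowup.CΛ 4 K (insert 0 (Fin.succ '' ((e.2.2 : Finset (Fin 4)) : Set (Fin 4)))) :
                  Set (P 4 K)))).Nonempty →
              idx₂ D₁ = idx₂ D₂ → D₁ = D₂)) ∧
        (kid e : Set W) ⊆ π ⁻¹' (φ '' (ψ ⁻¹'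
          (AffineCoordBlowup.CΛ 4 K (insert 0 (Fin.succ '' (S : Set (Fin 4)))) : Set (P 4 K)))) ∧
        (kid e : Set W).Nonempty ∧
        ∃ Θ : A 4 K ≃ₐ[K] A 4 K, (∀ i : Fin 4, Θ (X i.succ) = X i.succ + C (e.2.1 i)) ∧
          (controlledTransform B (AffineCoordBlowup.𝓘Λ 4 K (insert 0 (Fin.succ '' (S : Set (Fin 4))))) (hypSheaf p s.F) p).comap
              (Spec.map (CommRingCat.ofHom (Θ : A 4 K →+* A 4 K)) ≫
                AffineCoordBlowup.chartImm hB (ChartDictionary.succ_mem_centreVars (hP1 e he).1)) =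
            hypSheaf p (CentreBlowup.step p S e.1 e.2.1 s).F ∧
          ∀ (w : W) (hwV : w ∈ π ⁻¹ᵁ φ.opensRange), w ∈ (kid e : Set W) ↔
            ((B ⁻¹ᵁ ψ.opensRange).ι (ε.hom ⟨w, hwV⟩) : Bl) ∈
              (Spec.map (CommRingCat.ofHom (Θ : A 4 K →+* A 4 K)) ≫
                AffineCoordBlowup.chartImm hB (ChartDictionary.succ_mem_centreVars (hP1 e he).1)) ''
                (AffineCoordBlowup.CΛ 4 K (insert 0 (Fin.succ '' ((e.2.2 : Finset (Fin 4)) : Set (Fin 4)))) : Set (P 4 K))) ∧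
      (∀ e ∈ Pl, ∀ e' ∈ Pl, e ≠ e' → Disjoint (kid e : Set W) (kid e' : Set W)) ∧
      (∀ w : W, IsClosed ({w} : Set W) →
        π w ∈ φ '' (ψ ⁻¹' (AffineCoordBlowup.CΛ 4 K (insert 0 (Fin.succ '' (S : Set (Fin 4)))) : Set (P 4 K))) →
        (p : ℕ∞) ≤ idealOrder (M.transform π Zc).ideal w →
        (∃ e ∈ Pl, w ∈ (kid e : Set W)) ∨
        ∃ l ∈ L, l.1 ∈ S ∧ l.2 l.1 = 0 ∧ CentreBlowup.IsEquimultiplePoint p S l.1 l.2 s ∧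
          ∃ (Y' : Scheme.{0}) (φ' : Y' ⟶ W) (ψ' : Y' ⟶ P 4 K) (_ : IsOpenImmersion φ') (_ : IsOpenImmersion ψ')
            (y' : Y'), φ' y' = w ∧ ψ' y' = ξ 4 K ∧
            (M.transform π Zc).ideal.comap φ' = (hypSheaf p (CentreBlowup.step p S l.1 l.2 s).F).comap ψ') ∧
      {w : W | IsClosed ({w} : Set W) ∧
        π w ∈ φ '' (ψ ⁻¹' (AffineCoordBlowup.CΛ 4 K (insert 0 (Fin.succ '' (S : Set (Fin 4)))) : Set (P 4 K))) ∧
        (p : ℕ∞) ≤ idealOrder (M.transform π Zc).ideal w ∧ ∀ e ∈ Pl, w ∉ (kid e : Set W)}.Finite := by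
  classical
  haveI : IsProper π := hπ.isProper
  haveI : IsLocallyNoetherian W := LocallyOfFiniteType.isLocallyNoetherian π
  -- the children
  have kidEx := fun (e : Fin 4 × (Fin 4 → K) × Finset (Fin 4)) (he : e ∈ Pl) =>
    kid_package_of_iso φ ψ ε Zc hπ hB hsq hC' M hmult s hK hS.2 hsee hT hsncZ idx cst hshape hinj
      (hP1 e he).1 (hP1 e he).2.1 (hP1 e he).2.2.1
  let kid : Fin 4 × (Fin 4 → K) × Finset (Fin 4) → Closeds W := fun e =>
    if he : e ∈ Pl then (kidEx e he).choose else ⊥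
  have hkid : ∀ e (he : e ∈ Pl), kid e = (kidEx e he).choose := fun e he => dif_pos he
  -- model images of points over the member
  have hmodel := fun (w : W) (hw : IsClosed ({w} : Set W)) hwx
      (hord : (p : ℕ∞) ≤ idealOrder (M.transform π Zc).ideal w) =>
    leaf_model_point_normalised φ ψ ε Zc hB hsq M hmult s hK hS.2 hw hwx hord
  refine ⟨kid, fun e he => ?_, fun e he e' he' hne => ?_, fun w hw hwx hord => ?_, ?_⟩
  · -- data of a child, with its model description
    rw [hkid e he]
    obtain ⟨Θ, hs, hc, hmem, hover, hne, hreg, hsnc, hzig⟩ := (kidEx e he).choose_spec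
    exact ⟨hreg, hsnc, hzig, hover, hne, Θ, hs, hc, hmem⟩
  · -- the children are pairwise disjoint
    rw [hkid e he, hkid e' he']
    obtain ⟨Θ, hs, hc, hmem, hover, -⟩ := (kidEx e he).choose_spec
    obtain ⟨Θ', hs', hc', hmem', -, -⟩ := (kidEx e' he').choose_spec
    have hsR : ∀ k : Fin 4, (Θ : A 4 K →+* A 4 K) (X k.succ) = X k.succ + C (e.2.1 k) := fun k => hs k
    have hsR' : ∀ k : Fin 4, (Θ' : A 4 K →+* A 4 K) (X k.succ) = X k.succ + C (e'.2.1 k) := fun k => hs' k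
    have hCR : ∀ c : K, (Θ : A 4 K →+* A 4 K) (C c) = C c := fun c => Θ.commutes c
    have hCR' : ∀ c : K, (Θ' : A 4 K →+* A 4 K) (C c) = C c := fun c => Θ'.commutes c
    rw [Set.disjoint_left]
    intro w hw hw'
    have hwV : w ∈ π ⁻¹ᵁ φ.opensRange := by
      obtain ⟨y, -, hy⟩ := hover hw
      exact ⟨y, hy⟩
    have h1 := (hmem w hwV).mp hw
    have h2 := (hmem' w hwV).mp hw'
    rcases hP2 e he e' he' hne with ⟨hjj, i, hi, hi', hbi⟩ | ⟨hjj, hcase⟩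
    · -- same chart, separated
      obtain ⟨j, b, S''⟩ := e
      obtain ⟨j', b', S'''⟩ := e'
      simp only at hjj hi hi' hbi hsR hsR' h1 h2
      subst hjj
      exact Set.disjoint_left.mp (ChartDictionary.disjoint_image_CΛ_chart_of_ne (hP1 _ he).1 hCR hsR hCR' hsR' hB
        hi hi' hbi) h1 h2
    · rcases hcase with ⟨hb0, hjS⟩ | ⟨hb0, hjS⟩
      · exact Set.disjoint_left.mp (ChartDictionary.disjoint_image_CΛ_chart_of_ne_chart (hP1 e he).1 (hP1 e' he').1
          hjj hsR' hb0 hB hjS) h1 h2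
      · exact Set.disjoint_left.mp (ChartDictionary.disjoint_image_CΛ_chart_of_ne_chart (hP1 e' he').1 (hP1 e he).1
          (Ne.symm hjj) hsR hb0 hB hjS) h2 h1
  · -- a closed order-`p` point over the member: in a child, or a leaf
    obtain ⟨hwV, j', hj', x, a', b', hxw, hx, hab, hbj', hnorm, heq⟩ := hmodel w hw hwx hord
    rcases hP5 j' b' hj' hbj' hnorm heq with ⟨e, he, hej, hagree⟩ | hl
    · left
      refine ⟨e, he, ?_⟩
      rw [hkid e he]
      obtain ⟨Θ, hs, hc, hmem, -, -⟩ := (kidEx e he).choose_spec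
      obtain ⟨j, b, S''⟩ := e
      simp only at hej hagree hs hc hmem
      subst hej
      rw [hmem w hwV, ← hxw]
      exact ChartDictionary.mem_image_CΛ_chart_of_agree (hP1 _ he).1 hs hB hp.out.ne_zero s hS.2
        (hP1 _ he).2.2.2.2.2 hc hx hab hagree
    · right
      obtain ⟨Θ, -, -, -, hchart⟩ := leaf_chart φ ψ ε Zc hB M hmult s hK hS.2 hwV hj' hxw hx hab hbj'
      exact ⟨(j', b'), hl, hj', hbj', heq, hchart⟩
  · -- the leaf points are finitely many: they inject into `L`
    have cover : ∀ w : W, IsClosed ({w} : Set W) →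
        π w ∈ φ '' (ψ ⁻¹' (AffineCoordBlowup.CΛ 4 K (insert 0 (Fin.succ '' (S : Set (Fin 4)))) : Set (P 4 K))) →
        (p : ℕ∞) ≤ idealOrder (M.transform π Zc).ideal w → (∀ e ∈ Pl, w ∉ (kid e : Set W)) →
        ∃ l : Fin 4 × (Fin 4 → K), l ∈ L ∧ ∃ (hwV : w ∈ π ⁻¹ᵁ φ.opensRange) (hj : l.1 ∈ S) (x : P 4 K) (a : K),
          AffineCoordBlowup.chartImm hB (ChartDictionary.succ_mem_centreVars hj) x =
              (B ⁻¹ᵁ ψ.opensRange).ι (ε.hom ⟨w, hwV⟩) ∧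
            x.asIdeal = MvPolynomial.vanishingIdeal K {(Fin.cons a l.2 : Fin (4 + 1) → K)} ∧
              a ^ p + MvPolynomial.eval l.2 (CentreBlowup.chartTransform p S l.1 s.F) = 0 := by
      intro w hw hwx hord hout
      obtain ⟨hwV, j', hj', x, a', b', hxw, hx, hab, hbj', hnorm, heq⟩ := hmodel w hw hwx hord
      rcases hP5 j' b' hj' hbj' hnorm heq with ⟨e, he, hej, hagree⟩ | hl
      · exfalso
        apply hout e he
        rw [hkid e he]
        obtain ⟨Θ, hs, hc, hmem, -, -⟩ := (kidEx e he).choose_spec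
        obtain ⟨j, b, S''⟩ := e
        simp only at hej hagree hs hc hmem
        subst hej
        rw [hmem w hwV, ← hxw]
        exact ChartDictionary.mem_image_CΛ_chart_of_agree (hP1 _ he).1 hs hB hp.out.ne_zero s hS.2
          (hP1 _ he).2.2.2.2.2 hc hx hab hagree
      · exact ⟨(j', b'), hl, hwV, hj', x, a', hxw, hx, hab⟩
    let g : W → Fin 4 × (Fin 4 → K) := fun w =>
      if hc : IsClosed ({w} : Set W) ∧
          π w ∈ φ '' (ψ ⁻¹' (AffineCoordBlowup.CΛ 4 K (insert 0 (Fin.succ '' (S : Set (Fin 4)))) : Set (P 4 K))) ∧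
          (p : ℕ∞) ≤ idealOrder (M.transform π Zc).ideal w ∧ ∀ e ∈ Pl, w ∉ (kid e : Set W)
      then (cover w hc.1 hc.2.1 hc.2.2.1 hc.2.2.2).choose else ((0 : Fin 4), (0 : Fin 4 → K))
    refine Set.Finite.of_finite_image (f := g) ((Finset.finite_toSet L).subset ?_) ?_
    · rintro _ ⟨w, hw, rfl⟩
      have hg : g w = (cover w hw.1 hw.2.1 hw.2.2.1 hw.2.2.2).choose := dif_pos hw
      rw [hg]
      exact (cover w hw.1 hw.2.1 hw.2.2.1 hw.2.2.2).choose_spec.1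
    · intro w hw w' hw' hgg
      have hg : g w = (cover w hw.1 hw.2.1 hw.2.2.1 hw.2.2.2).choose := dif_pos hw
      have hg' : g w' = (cover w' hw'.1 hw'.2.1 hw'.2.2.1 hw'.2.2.2).choose := dif_pos hw'
      have key : ∀ l l' : Fin 4 × (Fin 4 → K), l = l' →
          (∃ (hwV : w ∈ π ⁻¹ᵁ φ.opensRange) (hj : l.1 ∈ S) (x : P 4 K) (a : K),
            AffineCoordBlowup.chartImm hB (ChartDictionary.succ_mem_centreVars hj) x =
                (B ⁻¹ᵁ ψ.opensRange).ι (ε.hom ⟨w, hwV⟩) ∧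
              x.asIdeal = MvPolynomial.vanishingIdeal K {(Fin.cons a l.2 : Fin (4 + 1) → K)} ∧
                a ^ p + MvPolynomial.eval l.2 (CentreBlowup.chartTransform p S l.1 s.F) = 0) →
          (∃ (hwV : w' ∈ π ⁻¹ᵁ φ.opensRange) (hj : l'.1 ∈ S) (x : P 4 K) (a : K),
            AffineCoordBlowup.chartImm hB (ChartDictionary.succ_mem_centreVars hj) x =
                (B ⁻¹ᵁ ψ.opensRange).ι (ε.hom ⟨w', hwV⟩) ∧
              x.asIdeal = MvPolynomial.vanishingIdeal K {(Fin.cons a l'.2 : Fin (4 + 1) → K)} ∧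
                a ^ p + MvPolynomial.eval l'.2 (CentreBlowup.chartTransform p S l'.1 s.F) = 0) →
          w = w' := by
        rintro l _ rfl ⟨hwV, hj, x, a, hxw, hx, hab⟩ ⟨hwV', hj', x', a', hxw', hx', hab'⟩
        have haa : a = a' := by
          apply frobenius_inj K p
          rw [frobenius_def, frobenius_def, eq_neg_of_add_eq_zero_left hab, eq_neg_of_add_eq_zero_left hab']
        have hxx : x = x' := by
          apply PrimeSpectrum.ext
          rw [hx, hx', haa]
        subst hxx
        have h1 : (B ⁻¹ᵁ ψ.opensRange).ι (ε.hom ⟨w, hwV⟩) = (B ⁻¹ᵁ ψ.opensRange).ι (ε.hom ⟨w', hwV'⟩) :=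
          hxw.symm.trans hxw'
        have h2 := ε.hom.isOpenEmbedding.injective ((B ⁻¹ᵁ ψ.opensRange).ι.isOpenEmbedding.injective h1)
        have h3 := Subtype.ext_iff.mp h2
        exact h3
      exact key _ _ (hg.symm.trans (hgg.trans hg')) (cover w hw.1 hw.2.1 hw.2.2.1 hw.2.2.2).choose_spec.2
        (cover w' hw'.1 hw'.2.1 hw'.2.2.1 hw'.2.2.2).choose_spec.2

end Assembly

end Equimultiple

end Summit.ResolutionOfSingularities.ResolutionOfSingularities.Theorems.PIDim4

end
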